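import Mathlib.Combinatorics.Hall.Basic
import Mathlib.Analysis.Complex.ExponentialBounds
import Mathlib.Data.Fintype.BigOperators
import Mathlib.Data.Fintype.Pi
import Mathlib.Data.Finset.Powerset
import Mathlib.Algebra.Order.BigOperators.Group.Finset
import Mathlib.Algebra.BigOperators.Ring.Finset
import Mathlib.Algebra.BigOperators.Group.Finset.Piecewise
import Mathlib.Tactic.Positivity
import Mathlib.Tactic.GCongr
import Mathlib.Tactic.Ring
import HarnessLib

/-!
# Sparse bipartite graphs with the Hall property for small sets (concentrators), by counting

The non-constructive ingredient of the Pinsker–Valiant–Pippenger linear-size superconcentrator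
([BurgisserClausenShokrollahi1997] Lemma (13.32): a bipartite graph with `6m` inputs of
out-degree `≤ 6` and `4m` outputs in which every `j`-set of inputs, `j ≤ 3m`, is matched into
the outputs; proved there by counting permutations with Stirling's formula; originally
Pinsker 1973 / Valiant 1976, cf. [Chung1997] Ch. 6, PDF pp. 82–83: "by using expanders, the
existence of which is guaranteed by probabilistic methods").

We prove the same kind of statement in the form that is cheapest to formalise, with our own
(cruder) constants: in the random FUNCTION model `f : α × δ → β` (every left vertex `x : α`
gets the `|δ|` labelled neighbours `f (x, c)`), the functions violating Hall's condition
`|N(S)| ≥ |S|` for some `S` with `|S| ≤ t` are fewer than all functions as soon as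
`18 · |α| · t ^ (|δ| - 2) ≤ |β| ^ (|δ| - 1)` (`exists_hallExpander`). The count is the textbook
union bound: a violating `f` maps `S × δ` into a `|S|`-set `Z`, there are
`C(|α|, k) · C(|β|, k)` pairs `(S, Z)` and `k^{k|δ|} · |β|^{(|α| - k)|δ|}` such functions
(`card_box`), and `C(a, k) C(b, k) k^{kd} 2^k ≤ b^{kd}` follows from `k! · C(n, k) ≤ n^k` and
`k^k ≤ 3^k · k!` (`pow_self_le_three_pow_mul_factorial`, from `x^n / n! ≤ exp x` and `e < 3`).
The specialisation used by `Literature.Barriers.PneNP.SuperconcentratorBarrier_holds` is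
`exists_halfConcentrator`: for every `a` there is a bipartite graph from `Fin a` to
`Fin (a - ⌊a/16⌋)` with left degrees `≤ 7` in which every set of at most `⌊a/2⌋` left
vertices satisfies Hall's condition; `exists_injective_of_hall` turns Hall's condition into
vertex-disjoint edges (Mathlib's `Finset.all_card_le_biUnion_card_iff_exists_injective`).

What is NOT here: the sharp constants (`36m` edges for `6m → 4m`, [BurgisserClausenShokrollahi1997]
Lemma (13.32); degree bounds on the output side), explicit expanders (Margulis, Gabber–Galil),
and any spectral notion of expansion.

## References

* [BurgisserClausenShokrollahi1997] P. Bürgisser, M. Clausen, M. A. Shokrollahi, *Algebraic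
  Complexity Theory* (1997), §13.4, Lemma (13.32) and Thm. (13.31) with proofs (PDF pp. 356–358) — held.
* [Chung1997] F. Chung, *Spectral Graph Theory* (1997), Ch. 6 (PDF pp. 82–83) — held.
-/

namespace Literature.Combinatorics.Expanders

open Finset

/-! ### Two elementary estimates -/

/-- `k^k ≤ 3^k · k!`, the crude form of Stirling's lower bound `k! ≥ (k/e)^k` used in the
union bound (from `x^n/n! ≤ eˣ` at `x = n` and `e < 3`). [folklore] -/
theorem pow_self_le_three_pow_mul_factorial (k : ℕ) : k ^ k ≤ 3 ^ k * k.factorial := by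
  have hfac : (0 : ℝ) < (k.factorial : ℝ) := by positivity
  have h1 : (k : ℝ) ^ k / (k.factorial : ℝ) ≤ Real.exp k :=
    Real.pow_div_factorial_le_exp (k : ℝ) (Nat.cast_nonneg k) k
  have h2 : Real.exp (k : ℝ) ≤ 3 ^ k := by
    rw [← mul_one (k : ℝ), Real.exp_nat_mul]
    exact pow_le_pow_left₀ (Real.exp_pos 1).le Real.exp_one_lt_three.le k
  have h3 : (k : ℝ) ^ k ≤ 3 ^ k * k.factorial := by
    rw [div_le_iff₀ hfac] at h1
    calc (k : ℝ) ^ k ≤ Real.exp k * k.factorial := h1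
      _ ≤ 3 ^ k * k.factorial := by gcongr
  exact_mod_cast h3

/-- If `x i · 2^(i+1) ≤ M` for all `i < t` and `M > 0` then `∑_{i<t} x i < M`
(geometric series). [folklore] -/
theorem sum_lt_of_mul_two_pow_le (x : ℕ → ℕ) {t M : ℕ} (hM : 0 < M)
    (h : ∀ i, i < t → x i * 2 ^ (i + 1) ≤ M) : ∑ i ∈ range t, x i < M := by
  have hgeom : ∀ s : ℕ, ∑ i ∈ range s, (1 / 2 : ℝ) ^ (i + 1) = 1 - (1 / 2) ^ s := by
    intro s
    induction s with
    | zero => simp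
    | succ s ih => rw [sum_range_succ, ih]; ring
  have hx : ∀ i ∈ range t, (x i : ℝ) ≤ M * (1 / 2 : ℝ) ^ (i + 1) := by
    intro i hi
    have h' : ((x i * 2 ^ (i + 1) : ℕ) : ℝ) ≤ M := by exact_mod_cast h i (mem_range.1 hi)
    have h2 : (0 : ℝ) < 2 ^ (i + 1) := by positivity
    rw [show (M : ℝ) * (1 / 2) ^ (i + 1) = M / 2 ^ (i + 1) by
      rw [one_div, inv_pow, div_eq_mul_inv]]
    rw [le_div_iff₀ h2]
    exact_mod_cast h'
  have hlt : ((∑ i ∈ range t, x i : ℕ) : ℝ) < M := by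
    rw [Nat.cast_sum]
    calc ∑ i ∈ range t, (x i : ℝ)
        ≤ ∑ i ∈ range t, (M : ℝ) * (1 / 2 : ℝ) ^ (i + 1) := sum_le_sum hx
      _ = M * (1 - (1 / 2) ^ t) := by rw [← mul_sum, hgeom]
      _ < M * 1 := by
          have hMr : (0 : ℝ) < M := by exact_mod_cast hM
          have hp : (0 : ℝ) < (1 / 2) ^ t := by positivity
          nlinarith
      _ = M := mul_one _
  exact_mod_cast hlt

/-! ### Counting the functions that violate Hall's condition -/

section Counting

variable {α β δ : Type*} [Fintype α] [DecidableEq α] [Fintype β] [DecidableEq β]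
  [Fintype δ] [DecidableEq δ]

omit [DecidableEq β] in
/-- The functions `α × δ → β` mapping `S × δ` into `Z` form a box in the function space with
`|Z|^{|S|·|δ|} · |β|^{(|α|-|S|)·|δ|}` elements. [folklore] -/
theorem card_box (S : Finset α) (Z : Finset β) :
    (Fintype.piFinset fun p : α × δ => if p.1 ∈ S then Z else univ).card =
      Z.card ^ (S.card * Fintype.card δ) *
        Fintype.card β ^ ((Fintype.card α - S.card) * Fintype.card δ) := by
  have hf1 : (univ.filter fun p : α × δ => p.1 ∈ S) = S ×ˢ (univ : Finset δ) := by
    ext p; simp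
  have hf2 : (univ.filter fun p : α × δ => ¬ p.1 ∈ S) = Sᶜ ×ˢ (univ : Finset δ) := by
    ext p; simp
  rw [Fintype.card_piFinset]
  simp only [apply_ite Finset.card, card_univ]
  rw [prod_ite, prod_const, prod_const, hf1, hf2, card_product, card_product, card_compl,
    card_univ]

/-- **Existence of a Hall expander by counting.** If `|δ| = d + 2`, `0 < |β|`, `t ≤ |β|` and
`18 · |α| · t^d ≤ |β|^(d+1)`, then some `f : α × δ → β` satisfies Hall's condition
`|S| ≤ |f(S × δ)|` for every `S ⊆ α` with `|S| ≤ t` (so every such `S` can be matched into `β`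
along edges `x → f (x, c)`). The counting form of [BurgisserClausenShokrollahi1997] Lemma (13.32)
(there: permutations, `6m → 4m`, `j ≤ 3m`), with cruder constants.
[cite: BurgisserClausenShokrollahi1997, Lemma (13.32) (PDF pp. 356–357)] -/
theorem exists_hallExpander (t d : ℕ) (hd : Fintype.card δ = d + 2) (hβ : 0 < Fintype.card β)
    (ht : t ≤ Fintype.card β)
    (hkey : 18 * Fintype.card α * t ^ d ≤ Fintype.card β ^ (d + 1)) :
    ∃ f : α × δ → β, ∀ S : Finset α, S.card ≤ t →
      S.card ≤ ((S ×ˢ (univ : Finset δ)).image f).card := by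
  classical
  set a := Fintype.card α with ha
  set b := Fintype.card β with hb
  -- the per-size estimate `C(a,k) C(b,k) k^{k(d+2)} b^{(a-k)(d+2)} 2^k ≤ b^{a(d+2)}`
  have hterm : ∀ k, 1 ≤ k → k ≤ t →
      a.choose k * b.choose k * (k ^ (k * (d + 2)) * b ^ ((a - k) * (d + 2))) * 2 ^ k ≤
        b ^ (a * (d + 2)) := by
    intro k hk1 hkt
    rcases lt_or_ge a k with hak | hka
    · rw [Nat.choose_eq_zero_of_lt hak]; simp
    have hsplit : b ^ (a * (d + 2)) = b ^ (k * (d + 2)) * b ^ ((a - k) * (d + 2)) := by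
      rw [← pow_add, ← Nat.add_mul, Nat.add_sub_cancel' hka]
    rw [hsplit]
    suffices hcore : a.choose k * b.choose k * k ^ (k * (d + 2)) * 2 ^ k ≤ b ^ (k * (d + 2)) by
      calc a.choose k * b.choose k * (k ^ (k * (d + 2)) * b ^ ((a - k) * (d + 2))) * 2 ^ k
          = (a.choose k * b.choose k * k ^ (k * (d + 2)) * 2 ^ k) * b ^ ((a - k) * (d + 2)) := by
            ring
        _ ≤ b ^ (k * (d + 2)) * b ^ ((a - k) * (d + 2)) := Nat.mul_le_mul_right _ hcore
    have hfa : k.factorial * a.choose k ≤ a ^ k := by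
      rw [← Nat.descFactorial_eq_factorial_mul_choose]; exact Nat.descFactorial_le_pow a k
    have hfb : k.factorial * b.choose k ≤ b ^ k := by
      rw [← Nat.descFactorial_eq_factorial_mul_choose]; exact Nat.descFactorial_le_pow b k
    have hkk : k ^ k ≤ 3 ^ k * k.factorial := pow_self_le_three_pow_mul_factorial k
    have hkd : 18 * a * k ^ d ≤ b ^ (d + 1) :=
      le_trans (Nat.mul_le_mul_left _ (Nat.pow_le_pow_left hkt d)) hkey
    have hpos : 0 < k.factorial * k.factorial * 9 ^ k := by positivity
    refine Nat.le_of_mul_le_mul_left ?_ hpos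
    calc k.factorial * k.factorial * 9 ^ k * (a.choose k * b.choose k * k ^ (k * (d + 2)) * 2 ^ k)
        = (k.factorial * a.choose k) * (k.factorial * b.choose k) * k ^ (k * (d + 2)) *
            (9 ^ k * 2 ^ k) := by ring
      _ ≤ a ^ k * b ^ k * k ^ (k * (d + 2)) * (9 ^ k * 2 ^ k) := by gcongr
      _ = (18 * a * k ^ d) ^ k * b ^ k * (k ^ k * k ^ k) := by
          rw [show (9 : ℕ) ^ k * 2 ^ k = 18 ^ k by rw [← mul_pow]; norm_num]
          ring
      _ ≤ (b ^ (d + 1)) ^ k * b ^ k * ((3 ^ k * k.factorial) * (3 ^ k * k.factorial)) := by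
          gcongr
      _ = k.factorial * k.factorial * 9 ^ k * b ^ (k * (d + 2)) := by
          rw [show (9 : ℕ) ^ k = 3 ^ k * 3 ^ k by rw [← mul_pow]; norm_num]
          ring
  -- the union bound
  let box : Finset α → Finset β → Finset (α × δ → β) := fun S Z =>
    Fintype.piFinset fun p : α × δ => if p.1 ∈ S then Z else univ
  let U : Finset (α × δ → β) := (range t).biUnion fun i =>
    (powersetCard (i + 1) (univ : Finset α)).biUnion fun S =>
      (powersetCard (i + 1) (univ : Finset β)).biUnion fun Z => box S Z
  have hbox_def : ∀ S Z, box S Z =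
      Fintype.piFinset (fun p : α × δ => if p.1 ∈ S then Z else univ) := fun _ _ => rfl
  have hbox : ∀ i, ∀ S ∈ powersetCard (i + 1) (univ : Finset α),
      ∀ Z ∈ powersetCard (i + 1) (univ : Finset β),
      (box S Z).card = (i + 1) ^ ((i + 1) * (d + 2)) * b ^ ((a - (i + 1)) * (d + 2)) := by
    intro i S hS Z hZ
    rw [hbox_def, card_box, (mem_powersetCard.1 hS).2, (mem_powersetCard.1 hZ).2, hd]
  have hU : U.card < b ^ (a * (d + 2)) := by
    calc U.card ≤ ∑ i ∈ range t, ((powersetCard (i + 1) (univ : Finset α)).biUnion fun S =>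
            (powersetCard (i + 1) (univ : Finset β)).biUnion fun Z => box S Z).card :=
          card_biUnion_le
      _ ≤ ∑ i ∈ range t, a.choose (i + 1) * b.choose (i + 1) *
            ((i + 1) ^ ((i + 1) * (d + 2)) * b ^ ((a - (i + 1)) * (d + 2))) := by
          refine sum_le_sum fun i _ => ?_
          calc ((powersetCard (i + 1) (univ : Finset α)).biUnion fun S =>
                (powersetCard (i + 1) (univ : Finset β)).biUnion fun Z => box S Z).card
              ≤ ∑ S ∈ powersetCard (i + 1) (univ : Finset α),
                  ((powersetCard (i + 1) (univ : Finset β)).biUnion fun Z => box S Z).card :=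
                card_biUnion_le
            _ ≤ ∑ S ∈ powersetCard (i + 1) (univ : Finset α),
                  ∑ Z ∈ powersetCard (i + 1) (univ : Finset β), (box S Z).card :=
                sum_le_sum fun S _ => card_biUnion_le
            _ = ∑ S ∈ powersetCard (i + 1) (univ : Finset α),
                  ∑ Z ∈ powersetCard (i + 1) (univ : Finset β),
                    (i + 1) ^ ((i + 1) * (d + 2)) * b ^ ((a - (i + 1)) * (d + 2)) :=
                sum_congr rfl fun S hS => sum_congr rfl fun Z hZ => hbox i S hS Z hZ
            _ = a.choose (i + 1) * b.choose (i + 1) *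
                  ((i + 1) ^ ((i + 1) * (d + 2)) * b ^ ((a - (i + 1)) * (d + 2))) := by
                rw [sum_const, smul_eq_mul, sum_const, smul_eq_mul, card_powersetCard,
                  card_powersetCard, card_univ, card_univ]
                ring
      _ < b ^ (a * (d + 2)) :=
          sum_lt_of_mul_two_pow_le _ (pow_pos hβ _) fun i hi => hterm (i + 1) i.succ_pos hi
  have hUuniv : U.card < (univ : Finset (α × δ → β)).card := by
    rw [card_univ, Fintype.card_fun, Fintype.card_prod, hd]
    exact hU
  obtain ⟨f, -, hfU⟩ := exists_mem_notMem_of_card_lt_card hUuniv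
  refine ⟨f, fun S hS => ?_⟩
  by_contra hle
  have hlt : ((S ×ˢ (univ : Finset δ)).image f).card < S.card := Nat.lt_of_not_le hle
  obtain ⟨Z, hZsub, hZcard⟩ :=
    Finset.exists_superset_card_eq (s := (S ×ˢ (univ : Finset δ)).image f) hlt.le (hS.trans ht)
  apply hfU
  simp only [U, mem_biUnion, mem_range, mem_powersetCard]
  refine ⟨S.card - 1, by omega, S, ⟨subset_univ _, by omega⟩, Z, ⟨subset_univ _, by omega⟩, ?_⟩
  rw [hbox_def, Fintype.mem_piFinset]
  intro p
  split_ifs with hp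
  · exact hZsub (mem_image_of_mem f (mem_product.2 ⟨hp, mem_univ _⟩))
  · exact mem_univ _

end Counting

/-! ### Hall's theorem: from expansion to vertex-disjoint edges -/

/-- Hall's marriage theorem in the form used for concentrators: if every `S ⊆ α` with
`|S| ≤ t` has `|N(S)| ≥ |S|`, then any family `g : ι ↪ α` of at most `t` left vertices can be
matched injectively into `β` along edges. [folklore] -/
theorem exists_injective_of_hall {ι α β : Type*} [Fintype ι] [DecidableEq α] [DecidableEq β]
    (N : α → Finset β) (t : ℕ)
    (h : ∀ S : Finset α, S.card ≤ t → S.card ≤ (S.biUnion N).card)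
    (g : ι → α) (hg : Function.Injective g) (hι : Fintype.card ι ≤ t) :
    ∃ μ : ι → β, Function.Injective μ ∧ ∀ x, μ x ∈ N (g x) := by
  classical
  refine (Finset.all_card_le_biUnion_card_iff_exists_injective fun x => N (g x)).1 fun s => ?_
  have hs : (s.image g).card = s.card := card_image_of_injective s hg
  have hst : (s.image g).card ≤ t := hs ▸ (card_le_univ s).trans hι
  have hsub : (s.image g).biUnion N ⊆ s.biUnion fun x => N (g x) := by
    intro y hy
    simp only [mem_biUnion, mem_image] at hy ⊢
    obtain ⟨a, ⟨x, hx, rfl⟩, hy⟩ := hy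
    exact ⟨x, hx, hy⟩
  calc s.card = (s.image g).card := hs.symm
    _ ≤ ((s.image g).biUnion N).card := h _ hst
    _ ≤ _ := card_le_card hsub

/-! ### The concentrator used for superconcentrators -/

/-- The arithmetic behind the parameters `t = ⌊a/2⌋`, `b = a - ⌊a/16⌋`, degree `7`:
`18 · a · ⌊a/2⌋^5 ≤ (a - ⌊a/16⌋)^6` (since `18/32 < (15/16)^6`). [folklore] -/
theorem key_ineq (a : ℕ) : 18 * a * (a / 2) ^ 5 ≤ (a - a / 16) ^ 6 := by
  have h2t : 2 * (a / 2) ≤ a := by omega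
  have hb : 15 * a ≤ 16 * (a - a / 16) := by omega
  have h3 : 32 * 16 ^ 6 * (18 * a * (a / 2) ^ 5) ≤ 32 * 16 ^ 6 * (a - a / 16) ^ 6 := by
    calc 32 * 16 ^ 6 * (18 * a * (a / 2) ^ 5) = 301989888 * (a * (2 * (a / 2)) ^ 5) := by ring
      _ ≤ 301989888 * (a * a ^ 5) := by gcongr
      _ ≤ 364500000 * (a * a ^ 5) := Nat.mul_le_mul_right _ (by norm_num)
      _ = 32 * (15 * a) ^ 6 := by ring
      _ ≤ 32 * (16 * (a - a / 16)) ^ 6 := by gcongr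
      _ = 32 * 16 ^ 6 * (a - a / 16) ^ 6 := by ring
  exact Nat.le_of_mul_le_mul_left h3 (by norm_num)

/-- **Half concentrators with `7a` edges.** For every `a` there is a bipartite graph from
`Fin a` to `Fin (a - ⌊a/16⌋)`, given by neighbourhoods `N x` of size `≤ 7`, in which every set
`S` of at most `⌊a/2⌋` left vertices has `|N(S)| ≥ |S|` (hence, by Hall, is matched into the
right side). The role of [BurgisserClausenShokrollahi1997] Lemma (13.32) (`6m → 4m`, `j ≤ 3m`,
out-degree `≤ 6`) with our constants.
[cite: BurgisserClausenShokrollahi1997, Lemma (13.32) (PDF pp. 356–357)] -/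
theorem exists_halfConcentrator (a : ℕ) :
    ∃ N : Fin a → Finset (Fin (a - a / 16)), (∀ x, (N x).card ≤ 7) ∧
      ∀ S : Finset (Fin a), S.card ≤ a / 2 → S.card ≤ (S.biUnion N).card := by
  classical
  rcases Nat.eq_zero_or_pos a with rfl | ha
  · refine ⟨fun x => x.elim0, fun x => x.elim0, fun S hS => ?_⟩
    have hS0 : S = ∅ := by
      ext x; exact x.elim0
    simp [hS0]
  have hb : 0 < a - a / 16 := by omega
  have ht : a / 2 ≤ a - a / 16 := by omega
  have hkey := key_ineq a
  obtain ⟨f, hf⟩ := exists_hallExpander (α := Fin a) (β := Fin (a - a / 16)) (δ := Fin 7)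
    (a / 2) 5 (by simp) (by simpa using hb) (by simpa using ht) (by simpa using hkey)
  refine ⟨fun x => (univ : Finset (Fin 7)).image fun c => f (x, c), fun x => ?_, fun S hS => ?_⟩
  · exact card_image_le.trans (by simp)
  · have heq : (S ×ˢ (univ : Finset (Fin 7))).image f =
        S.biUnion fun x => (univ : Finset (Fin 7)).image fun c => f (x, c) := by
      ext y
      simp only [mem_image, mem_biUnion, mem_product, mem_univ, and_true, true_and, Prod.exists]
      constructor
      · rintro ⟨x, c, hx, rfl⟩; exact ⟨x, hx, c, rfl⟩
      · rintro ⟨x, hx, c, rfl⟩; exact ⟨x, c, hx, rfl⟩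
    rw [← heq]
    exact hf S hS

end Literature.Combinatorics.Expanders
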